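import Summits.AtomisticToContinuum.Crystallization.Theorems.ExcessDecayLiouvilleStepGradient
import Summits.AtomisticToContinuum.Crystallization.Theorems.ExcessDecayLiouvilleCurrenciesV
import Summits.AtomisticToContinuum.Crystallization.Theorems.ExcessDecayLiouvilleComparisonBound

/-!
# Route `ExcessDecayLiouville`: the gradient currency of the step field (nonlinear half, XXI)

Harmonic-replacement architecture for item `ExcessDecay` (stmt-AtomisticToContinuum-9334), nonlinear half.
`step_gradient` at `(a, 2a)` about a centre `c₀ ∈ B_{r/8}(c)` (`ρ ≤ a`, `32a ≤ r`), with every value currency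
replaced by its envelope bound (`mass_le_cubic`, `farMass_le_cubic`, `NN_le_mass`, the forcing bound `Φ₀` on
`B_{r/4}(c)`, the crude bound `D_u` of `ũ` on `SR`): `NN_le_currency`.  The sums over `SR` are compared with
the masses by `sum_filter_le_mass`; the far flux sum splits into the sites of `B_{r/2}(c)` (where `ũ = v`,
`farSum_le`) and the rest (distance `≥ 3r/8` from `c₀`).
All `[folklore]`; helper lemmas, nothing here closes an item.
-/

noncomputable section

namespace Summit.AtomisticToContinuum.Crystallization.Theorems.ExcessDecayLiouville

open scoped BigOperators Topology InnerProductSpace RealInnerProductSpace Classical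
open Literature.MathematicalPhysics.StatisticalMechanics
open Summit.AtomisticToContinuum.Crystallization.Theorems.PhononStabilityNegative

-- Local notation: the force-constant map `K(e)w = h(|e|²)w + 2⟪e,w⟫h′(|e|²)e`.
local notation3 "𝕂[" e "] " w:max =>
  (-((‖e‖ ^ 2)⁻¹) ^ 7 + ((‖e‖ ^ 2)⁻¹) ^ 4) • w + (2 * ⟪e, w⟫ * (7 * ((‖e‖ ^ 2)⁻¹) ^ 8 - 4 * ((‖e‖ ^ 2)⁻¹) ^ 5)) • e
-- Local notation: the pair force `F(x) = h(|x|²) x`.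
local notation3 "𝐅[" x "]" => ((-((‖x‖ ^ 2)⁻¹) ^ 7 + ((‖x‖ ^ 2)⁻¹) ^ 4) • x)
set_option quotPrecheck false in
-- Local notation: ball indicator.
local notation "𝟙ᵇ[" x ", " c ", " R "]" => (if dist (x : EuclideanSpace ℝ (Fin 3)) c ≤ R then (1 : ℝ) else 0)

section

variable {t : Fin 2 → (EuclideanSpace ℝ (Fin 3))} {A : (EuclideanSpace ℝ (Fin 3)) →L[ℝ] (EuclideanSpace ℝ (Fin 3))}
  {c₀ : EuclideanSpace ℝ (Fin 3)}

variable (hA : Adm₀ A) (hI : Inner₀ t A)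

set_option quotPrecheck false in
-- local mass on the ball of radius `X` about `c₀`
local notation "𝐌[" f ", " X "]" =>
  tsum (fun p : Sites₀ t A => ‖f (p : EuclideanSpace ℝ (Fin 3))‖ ^ 2 * 𝟙ᵇ[p, c₀, X])
set_option quotPrecheck false in
-- weighted far mass with floor `Y` about `c₀`
local notation "𝐉[" f ", " Y "]" =>
  tsum (fun q : Sites₀ t A => ‖f (q : EuclideanSpace ℝ (Fin 3))‖ ^ 2 * (max (dist (q : EuclideanSpace ℝ (Fin 3)) c₀) Y)⁻¹ ^ 8)

include hA hI in
/-- **A sum of `‖f‖²` over sites of a ball is below the local mass.** [folklore] -/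
theorem sum_filter_le_mass (f : (EuclideanSpace ℝ (Fin 3)) → (EuclideanSpace ℝ (Fin 3)))
    (SR : Finset (EuclideanSpace ℝ (Fin 3))) (hSRS : ∀ x ∈ SR, x ∈ Sites₀ t A) (X : ℝ) :
    ∑ x ∈ SR.filter (fun p => dist p c₀ ≤ X), ‖f x‖ ^ 2 ≤ 𝐌[f, X] := by
  rw [tsum_indicator_eq_sum hA hI (fun x => ‖f x‖ ^ 2) c₀ X]
  refine Finset.sum_le_sum_of_subset_of_nonneg (fun x hx => ?_) fun _ _ _ => by positivity
  rw [Finset.mem_filter] at hx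
  exact (Set.Finite.mem_toFinset _).2 ⟨hSRS x hx.1, hx.2⟩

include hA hI in
/-- **The far flux sum against the envelope**: the sites of `SR ∩ B_{r/2}(c)` beyond `4a` from `c₀` carry
`ũ = v` and contribute at most `𝐉[v, 4a]`; the other sites of `SR` are `≥ 3r/8` from `c₀`. [folklore] -/
theorem farSum_le {c : EuclideanSpace ℝ (Fin 3)} {r : ℝ} (hr : 8 ≤ r)
    (u v : (EuclideanSpace ℝ (Fin 3)) → (EuclideanSpace ℝ (Fin 3)))
    (SR : Finset (EuclideanSpace ℝ (Fin 3))) (hSR : ∀ x, x ∈ SR ↔ x ∈ Sites₀ t A ∧ dist x c ≤ r)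
    (huv : ∀ q ∈ SR, dist q c ≤ r / 2 → u q = v q) {Du : ℝ} (hDu : ∀ q ∈ SR, ‖u q‖ ≤ Du)
    (hv : (Function.support v).Finite) (hc₀ : dist c₀ c ≤ r / 8) {a : ℝ} (ha : 0 < a) (har : 32 * a ≤ r) :
    ∑ q ∈ SR.filter (fun q => ¬ dist q c₀ ≤ 4 * a), (dist q c₀)⁻¹ ^ 8 * ‖u q‖ ^ 2 ≤
      𝐉[v, 4 * a] + 32 * r ^ 3 * ((3 * r / 8)⁻¹ ^ 8 * Du ^ 2) := by
  classical
  have hSRS : ∀ x ∈ SR, x ∈ Sites₀ t A := fun x hx => ((hSR x).1 hx).1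
  have hr0 : 0 < r := by linarith
  -- split SR by dist q c ≤ r/2
  rw [← Finset.sum_filter_add_sum_filter_not _ (fun q => dist q c ≤ r / 2)]
  refine add_le_add ?_ ?_
  · -- inner sites: u = v, weight = max(d, 4a)⁻⁸
    have hsJ := summable_normSq_mul_of_finite (t := t) (A := A) hv
      (fun q => (max (dist (q : EuclideanSpace ℝ (Fin 3)) c₀) (4 * a))⁻¹ ^ 8)
    have hmem : ∀ q ∈ (SR.filter (fun q => ¬ dist q c₀ ≤ 4 * a)).filter (fun q => dist q c ≤ r / 2), q ∈ Sites₀ t A :=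
      fun q hq => hSRS q (Finset.mem_filter.1 (Finset.mem_filter.1 hq).1).1
    calc ∑ q ∈ (SR.filter (fun q => ¬ dist q c₀ ≤ 4 * a)).filter (fun q => dist q c ≤ r / 2), (dist q c₀)⁻¹ ^ 8 * ‖u q‖ ^ 2
        = ∑ q ∈ (SR.filter (fun q => ¬ dist q c₀ ≤ 4 * a)).filter (fun q => dist q c ≤ r / 2),
            ‖v q‖ ^ 2 * (max (dist q c₀) (4 * a))⁻¹ ^ 8 := by
          refine Finset.sum_congr rfl fun q hq => ?_
          rw [Finset.mem_filter, Finset.mem_filter] at hq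
          rw [huv q hq.1.1 hq.2, max_eq_left (lt_of_not_ge hq.1.2).le]; ring
      _ ≤ _ := by
          rw [← Finset.sum_subtype_of_mem (f := fun q => ‖v q‖ ^ 2 * (max (dist q c₀) (4 * a))⁻¹ ^ 8) hmem]
          exact hsJ.sum_le_tsum _ fun q _ => by positivity
  · -- outer sites: distance ≥ 3r/8 from c₀
    have hterm : ∀ q ∈ (SR.filter (fun q => ¬ dist q c₀ ≤ 4 * a)).filter (fun q => ¬ dist q c ≤ r / 2),
        (dist q c₀)⁻¹ ^ 8 * ‖u q‖ ^ 2 ≤ (3 * r / 8)⁻¹ ^ 8 * Du ^ 2 := by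
      intro q hq
      rw [Finset.mem_filter, Finset.mem_filter] at hq
      have hqc : r / 2 < dist q c := lt_of_not_ge hq.2
      have hd : 3 * r / 8 ≤ dist q c₀ := by
        have := dist_triangle q c₀ c; linarith
      have h38 : 0 < 3 * r / 8 := by linarith
      have h1 : (dist q c₀)⁻¹ ^ 8 ≤ (3 * r / 8)⁻¹ ^ 8 :=
        pow_le_pow_left₀ (by positivity) ((inv_le_inv₀ (by linarith) h38).2 hd) 8
      have h2 : ‖u q‖ ^ 2 ≤ Du ^ 2 := pow_le_pow_left₀ (norm_nonneg _) (hDu q hq.1.1) 2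
      exact mul_le_mul h1 h2 (sq_nonneg _) (by positivity)
    have hcard : (((SR.filter (fun q => ¬ dist q c₀ ≤ 4 * a)).filter (fun q => ¬ dist q c ≤ r / 2)).card : ℝ) ≤ 32 * r ^ 3 :=
      card_ball_sites_le hA hI c (by linarith) _ fun q hq => by
        rw [Finset.mem_filter, Finset.mem_filter] at hq
        exact (hSR q).1 hq.1.1
    calc _ ≤ ∑ q ∈ (SR.filter (fun q => ¬ dist q c₀ ≤ 4 * a)).filter (fun q => ¬ dist q c ≤ r / 2), (3 * r / 8)⁻¹ ^ 8 * Du ^ 2 :=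
          Finset.sum_le_sum hterm
      _ = ((SR.filter (fun q => ¬ dist q c₀ ≤ 4 * a)).filter (fun q => ¬ dist q c ≤ r / 2)).card * ((3 * r / 8)⁻¹ ^ 8 * Du ^ 2) := by
          rw [Finset.sum_const, nsmul_eq_mul]
      _ ≤ 32 * r ^ 3 * ((3 * r / 8)⁻¹ ^ 8 * Du ^ 2) := mul_le_mul_of_nonneg_right hcard (by positivity)

end

section

variable {X : Set (EuclideanSpace ℝ (Fin 3))} {c : EuclideanSpace ℝ (Fin 3)} {r ε κ : ℝ}
  {t : Fin 2 → EuclideanSpace ℝ (Fin 3)} {A : EuclideanSpace ℝ (Fin 3) →L[ℝ] EuclideanSpace ℝ (Fin 3)}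
  {π : EuclideanSpace ℝ (Fin 3) → EuclideanSpace ℝ (Fin 3)}
  {aff : (EuclideanSpace ℝ (Fin 3)) → (EuclideanSpace ℝ (Fin 3))} {a : Fin 2 → EuclideanSpace ℝ (Fin 3)}
  {B : (EuclideanSpace ℝ (Fin 3)) →L[ℝ] (EuclideanSpace ℝ (Fin 3))} {c₀ : EuclideanSpace ℝ (Fin 3)}

variable (hA : Adm₀ A) (hI : Inner₀ t A)

set_option quotPrecheck false in
-- Local notation: the operator row `(L v)(p)`.
local notation "𝕃" v:max " @ " p:max =>
  tsum (fun q : Sites₀ t A => (if ((p : Sites₀ t A) : EuclideanSpace ℝ (Fin 3)) ≠ q then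
    𝕂[((p : Sites₀ t A) : EuclideanSpace ℝ (Fin 3)) - q] (v ((p : Sites₀ t A) : EuclideanSpace ℝ (Fin 3)) - v q) else 0))
set_option quotPrecheck false in
-- Local notation: the finite near-neighbour form on the ball of radius `X` about `c₀`.
local notation "NN[" v ", " X "]" =>
  (∑ p ∈ (finite_sites_dist_le (t := t) (A := A) hA hI c₀ X).toFinset,
    ∑ q ∈ (finite_sites_dist_le (t := t) (A := A) hA hI c₀ X).toFinset,
      (if p ≠ q ∧ dist p q ≤ 11 / 10 then ‖v p - v q‖ ^ 2 else (0 : ℝ)))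
set_option quotPrecheck false in
-- local mass on the ball of radius `X` about `c₀`
local notation "𝐌[" f ", " X "]" =>
  tsum (fun p : Sites₀ t A => ‖f (p : EuclideanSpace ℝ (Fin 3))‖ ^ 2 * 𝟙ᵇ[p, c₀, X])
set_option quotPrecheck false in
-- weighted far mass with floor `Y` about `c₀`
local notation "𝐉[" f ", " Y "]" =>
  tsum (fun q : Sites₀ t A => ‖f (q : EuclideanSpace ℝ (Fin 3))‖ ^ 2 * (max (dist (q : EuclideanSpace ℝ (Fin 3)) c₀) Y)⁻¹ ^ 8)

include hA hI in
/-- **The gradient currency** (see the module docstring); `v` and `ũ` are the cut-off and the bare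
displacement, passed as variables with their defining equations. [folklore] -/
theorem NN_le_currency (hκ0 : 0 < κ)
    (hκ : ∀ v : (EuclideanSpace ℝ (Fin 3)) → (EuclideanSpace ℝ (Fin 3)), (Function.support v).Finite →
      Function.support v ⊆ Sites₀ t A → κ * nnForm t A v ≤ ∑' p : Sites₀ t A, ⟪𝕃 v @ p, v p⟫)
    (hX : X.Finite) (hequil : Equil₀ X) (hr : 8 ≤ r)
    (hπ : ∀ s' ∈ Sites₀ t A, dist s' c ≤ r → π s' ∈ X ∧ dist (π s') s' ≤ ε)
    (hinj : ∀ s₁ ∈ Sites₀ t A, ∀ s₂ ∈ Sites₀ t A, dist s₁ c ≤ r → dist s₂ c ≤ r → π s₁ = π s₂ → s₁ = s₂)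
    (SR : Finset (EuclideanSpace ℝ (Fin 3))) (hSR : ∀ x, x ∈ SR ↔ x ∈ Sites₀ t A ∧ dist x c ≤ r)
    (χ : EuclideanSpace ℝ (Fin 3) → ℝ) (hχ0 : ∀ q ∈ Sites₀ t A, q ∉ SR → χ q = 0) (hχS : ∀ x, x ∉ Sites₀ t A → χ x = 0)
    (hχabs : ∀ x, |χ x| ≤ 1) (hχone : ∀ q ∈ SR, dist q c ≤ r / 2 → χ q = 1)
    (haff : ∀ (m : Fin 2) (z : EuclideanSpace ℝ (Fin 3)), z ∈ Λ₀ → aff (t m + A z) = a m + B (t m + A z - c₀))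
    {D₀ : ℝ} (hD₀ : 0 ≤ D₀) (hD₀' : D₀ ≤ 1 / 10) (hsmall : ‖a 0 - a 1‖ + 2 * r * ‖B‖ ≤ 1 / 50)
    (v ut : (EuclideanSpace ℝ (Fin 3)) → (EuclideanSpace ℝ (Fin 3)))
    (hvdef : v = fun x => χ x • ((π x - x) - aff x)) (hudef : ut = fun x => (π x - x) - aff x)
    (hD : ∀ x ∈ SR, ‖ut x‖ ≤ D₀ / 2)
    (hΛκ : 4000000 * (210000 * ((25 / 23) * (D₀ + ‖a 0 - a 1‖) + ‖B‖)) ≤ κ / 12)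
    (hv : (Function.support v).Finite)
    (hc₀ : dist c₀ c ≤ r / 8)
    -- the forcing bound on B_{r/4}(c)
    (φ : (EuclideanSpace ℝ (Fin 3)) → (EuclideanSpace ℝ (Fin 3)))
    (hφdef : φ = fun s : EuclideanSpace ℝ (Fin 3) =>
          (-(∑ s' ∈ SR.erase s, 𝐅[(s - s') + (aff s - aff s')]) -
            (∑ q ∈ (hX.toFinset.erase (π s)) \ ((SR.erase s).image π),
              (deriv lennardJones (dist (π s) q) / dist (π s) q) • (π s - q)) +
            ((∑ s' ∈ SR.erase s, 𝕂[s - s'] ((1 - χ s') • ((π s' - s') - aff s'))) +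
              ∑' q : ↑((SR.subtype (· ∈ Sites₀ t A) : Set (Sites₀ t A)))ᶜ,
                (if s ≠ (q : EuclideanSpace ℝ (Fin 3)) then 𝕂[s - (q : EuclideanSpace ℝ (Fin 3))] ((π s - s) - aff s) else 0))))
    {Φ₀ : ℝ} (hΦ₀ : 0 ≤ Φ₀)
    (hφ : ∀ (p : Sites₀ t A), (p : EuclideanSpace ℝ (Fin 3)) ∈ SR → dist (p : EuclideanSpace ℝ (Fin 3)) c ≤ r / 4 → ‖φ p‖ ≤ Φ₀)
    -- the envelope of v
    {C ρ Dv : ℝ} (hC : 0 ≤ C)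
    (henv : ∀ x ∈ Sites₀ t A, dist x c₀ ≤ r / 4 → ‖v x‖ ^ 2 ≤ C * (max (dist x c₀) ρ) ^ 3)
    (hvD : ∀ x, ‖v x‖ ≤ Dv)
    (hsupp : ∀ x ∈ Sites₀ t A, 7 * r / 8 < dist x c₀ → v x = 0)
    {a₁ : ℝ} (ha₁ : 1 ≤ a₁) (hρa : ρ ≤ a₁) (har : 32 * a₁ ≤ r) :
    NN[v, a₁] ≤ 2 ^ (5 + 1) *
        (((2 / κ * (19 * 16 * (1024 / ((23 / 25 : ℝ) ^ 3 * (23 / 25 : ℝ) ^ 3))) +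
            16 * (11 / 10 : ℝ) ^ 8 * (1024 / ((23 / 25 : ℝ) ^ 3 * (23 / 25 : ℝ) ^ 3))) *
            (32 * C * (4 * a₁) ^ 6) * (2 * a₁ - a₁) ^ 3 +
          2 / κ * (38 * 4 ^ 5 * (1024 / (23 / 25 : ℝ) ^ 3) * (32 * C * (4 * a₁) ^ 6) +
            (210000 * ((25 / 23) * (D₀ + ‖a 0 - a 1‖) + ‖B‖)) * 20 ^ 5 * ((7 / 2) * (1024 / (23 / 25 : ℝ) ^ 3) *
              (32 * C * (2 * a₁) ^ 6) + ((1024 / (23 / 25 : ℝ) ^ 3) * (32 * C * (4 * a₁) ^ 6)) / 2)) +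
          120 ^ 5 * (160 * (32 * C * (2 * a₁) ^ 6))) / (2 * a₁ - a₁) ^ 5) +
      2 * (2 / κ * (Φ₀ * (Real.sqrt (32 * (2 * a₁) ^ 3) * Real.sqrt (32 * C * (2 * a₁) ^ 6)) +
          (210000 * ((25 / 23) * (D₀ + ‖a 0 - a 1‖) + ‖B‖)) *
            (8192 * (2 * a₁) ^ 3 * ((4096 * C / (4 * a₁) ^ 2 + 8192 * (7 * r / 8) ^ 3 * Dv ^ 2 / ((r / 4) ^ 7 * (4 * a₁))) +
              32 * r ^ 3 * ((3 * r / 8)⁻¹ ^ 8 * (D₀ / 2) ^ 2))) / 2 +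
          19 * 8192 * (2 * a₁) ^ 3 * (4096 * C / a₁ ^ 2 + 8192 * (7 * r / 8) ^ 3 * Dv ^ 2 / ((r / 4) ^ 7 * a₁)))) := by
  have hSRS : ∀ x ∈ SR, x ∈ Sites₀ t A := fun x hx => ((hSR x).1 hx).1
  have ha0 : 0 < a₁ := by linarith
  have hr0 : 0 < r := by linarith
  -- the raw step_gradient bound at (a₁, 2a₁), folded into v, ũ, φ
  have hD' : ∀ x ∈ SR, ‖(π x - x) - aff x‖ ≤ D₀ / 2 := fun x hx => by
    have := hD x hx; rw [hudef] at this; exact this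
  have hv' : (Function.support (fun x => χ x • ((π x - x) - aff x))).Finite := by rw [hvdef] at hv; exact hv
  have hraw := step_gradient hA hI hκ0 hκ hX hequil hπ hinj SR hSR χ hχ0 hχS hχabs (le_of_lt (by linarith : r / 2 < r))
    hχone haff hD₀ hD₀' hsmall hD' hΛκ hv' ha₁ (by linarith : a₁ < 2 * a₁)
    (by linarith : dist c₀ c + 2 * a₁ ≤ r / 2) (c₀ := c₀)
  rw [← hvdef, ← hudef, ← hφdef] at hraw
  refine hraw.trans ?_
  -- the currencies
  have hM4 : 𝐌[v, 2 * (2 * a₁)] ≤ 32 * C * (4 * a₁) ^ 6 := by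
    rw [show 2 * (2 * a₁) = 4 * a₁ by ring]
    exact mass_le_cubic hA hI v hC henv (by linarith) (by linarith) (by linarith)
  have hM2 : 𝐌[v, 2 * a₁] ≤ 32 * C * (2 * a₁) ^ 6 :=
    mass_le_cubic hA hI v hC henv (by linarith) (by linarith) (by linarith)
  have hE2 : ∑ x ∈ SR.filter (fun p => dist p c₀ ≤ 2 * a₁), ‖v x‖ ^ 2 ≤ 32 * C * (2 * a₁) ^ 6 :=
    (sum_filter_le_mass hA hI v SR hSRS _).trans hM2
  -- ũ = v on the sites of SR ∩ B_{r/2}(c)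
  have huv : ∀ q ∈ SR, dist q c ≤ r / 2 → ut q = v q := by
    intro q hq hqc
    rw [hvdef, hudef]; simp only []
    rw [hχone q hq hqc, one_smul]
  have hE4 : ∑ q ∈ SR.filter (fun q => dist q c₀ ≤ 2 * (2 * a₁)), ‖ut q‖ ^ 2 ≤ 32 * C * (4 * a₁) ^ 6 := by
    calc _ = ∑ q ∈ SR.filter (fun q => dist q c₀ ≤ 2 * (2 * a₁)), ‖v q‖ ^ 2 := by
          refine Finset.sum_congr rfl fun q hq => ?_
          rw [Finset.mem_filter] at hq
          rw [huv q hq.1 (by have := dist_triangle q c₀ c; linarith)]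
      _ ≤ _ := (sum_filter_le_mass hA hI v SR hSRS _).trans hM4
  have hN2 : NN[v, 2 * a₁] ≤ 160 * (32 * C * (2 * a₁) ^ 6) :=
    (NN_le_mass hA hI v _).trans (mul_le_mul_of_nonneg_left hM2 (by norm_num))
  -- the forcing work on B_{2a₁}(c₀)
  have hP2 : ∑ x ∈ SR.filter (fun p => dist p c₀ ≤ 2 * a₁), ‖φ x‖ * ‖v x‖ ≤
      Φ₀ * (Real.sqrt (32 * (2 * a₁) ^ 3) * Real.sqrt (32 * C * (2 * a₁) ^ 6)) := by
    have hmem : ∀ x ∈ SR.filter (fun p => dist p c₀ ≤ 2 * a₁), x ∈ Sites₀ t A ∧ dist x c₀ ≤ 2 * a₁ := fun x hx => by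
      rw [Finset.mem_filter] at hx; exact ⟨hSRS x hx.1, hx.2⟩
    calc _ ≤ ∑ x ∈ SR.filter (fun p => dist p c₀ ≤ 2 * a₁), Φ₀ * ‖v x‖ := by
          refine Finset.sum_le_sum fun x hx => mul_le_mul_of_nonneg_right ?_ (norm_nonneg _)
          obtain ⟨hxS, hxd⟩ := hmem x hx
          exact hφ ⟨x, hxS⟩ (Finset.mem_filter.1 hx).1 (by have := dist_triangle x c₀ c; linarith)
      _ = Φ₀ * ∑ x ∈ SR.filter (fun p => dist p c₀ ≤ 2 * a₁), ‖v x‖ := by rw [Finset.mul_sum]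
      _ ≤ Φ₀ * (Real.sqrt (SR.filter (fun p => dist p c₀ ≤ 2 * a₁)).card *
            Real.sqrt (∑ x ∈ SR.filter (fun p => dist p c₀ ≤ 2 * a₁), ‖v x‖ ^ 2)) :=
          mul_le_mul_of_nonneg_left sum_norm_le_sqrt_card_mul hΦ₀
      _ ≤ Φ₀ * (Real.sqrt (32 * (2 * a₁) ^ 3) * Real.sqrt (32 * C * (2 * a₁) ^ 6)) := by
          refine mul_le_mul_of_nonneg_left (mul_le_mul (Real.sqrt_le_sqrt ?_) (Real.sqrt_le_sqrt hE2)
            (Real.sqrt_nonneg _) (Real.sqrt_nonneg _)) hΦ₀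
          exact card_ball_sites_le hA hI c₀ (by linarith) _ hmem
  -- the far sums
  have hsupp' : ∀ x, v x ≠ 0 → x ∈ Sites₀ t A := by
    intro x hx
    by_contra h
    apply hx
    rw [hvdef]; simp only []
    rw [hχS x h, zero_smul]
  have hJ1 : 𝐉[v, a₁] ≤ 4096 * C / a₁ ^ 2 + 8192 * (7 * r / 8) ^ 3 * Dv ^ 2 / ((r / 4) ^ 7 * a₁) :=
    farMass_le_cubic hA hI v hv hC (by linarith) (by linarith) henv hvD hsupp hsupp' ha₁ hρa
  have hJ4 : 𝐉[v, 4 * a₁] ≤ 4096 * C / (4 * a₁) ^ 2 + 8192 * (7 * r / 8) ^ 3 * Dv ^ 2 / ((r / 4) ^ 7 * (4 * a₁)) :=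
    farMass_le_cubic hA hI v hv hC (by linarith) (by linarith) henv hvD hsupp hsupp' (by linarith) (by linarith)
  have hfar : ∑ q ∈ SR.filter (fun q => ¬ dist q c₀ ≤ 2 * (2 * a₁)), (dist q c₀)⁻¹ ^ 8 * ‖ut q‖ ^ 2 ≤
      (4096 * C / (4 * a₁) ^ 2 + 8192 * (7 * r / 8) ^ 3 * Dv ^ 2 / ((r / 4) ^ 7 * (4 * a₁))) +
        32 * r ^ 3 * ((3 * r / 8)⁻¹ ^ 8 * (D₀ / 2) ^ 2) := by
    rw [show 2 * (2 * a₁) = 4 * a₁ by ring]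
    exact (farSum_le hA hI hr ut v SR hSR huv hD hv hc₀ ha0 har).trans (add_le_add hJ4 le_rfl)
  -- monotonicity
  have hΛ0 : 0 ≤ 210000 * ((25 / 23) * (D₀ + ‖a 0 - a 1‖) + ‖B‖) := by positivity
  have hden : 0 < (2 * a₁ - a₁) := by linarith
  gcongr

end

end Summit.AtomisticToContinuum.Crystallization.Theorems.ExcessDecayLiouville

end
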